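import Summits.QuantumFields.BalabanUV.T4Continuum.Support.VariationalVectorOneStepPhys
import Summits.QuantumFields.BalabanUV.T4Continuum.Support.VariationalVectorPoincareNear

/-!
# T⁴ programme, spine node NE2 (U1a), lane P2 — SUPPLIER LEAF V-ONE FOR E-VALUED 1-FORMS («V-ONE-1F»), file 6: GENERAL LINE TRANSPORTS BY
# CONSTRAINT REPAIR — the curl half of `hONE` for ANY line-indexed carrier `Q_T` within `γ` of the frame-adapted one, given leaf V-UB for `Q_T`

NE2 formalisation swarm `b2b-balaban-t4-ne2-formalise-*`, leaf prover 01 GEN 6 (`prover-b2b-balaban-t4-ne2-formalise-leaf-01-g6-0`); file 6 of the V-ONE-1F line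
(route (ii) of N-ne2leaf02g4-1, now with a ZEROTH-order constraint defect only).  The tower's carriers are general line-indexed transports `QvL (T k)` (retired
road owner's RULING l.11674; leaf-10-g3's `VariationalVectorTower` p218948); files 1–5 give the one-step competitor for the FRAME-ADAPTED member
`frameT U′ Rc` of that class, where the constraint is exact.  For an actual carrier `T` with `‖T(y,j,t,ν) − frameT U′ Rc (y,j,t,ν)‖ ≤ γ` (for Bałaban's
contour-and-line transports `γ` is a holonomy defect, `O(L²·a_fine)` — the taxi ∕ CLASS lineage's number, NOT supplied here) the same competitor misses the
constraint by `r = (Q_T − Q_{frameT})Λ′` with `Σ‖r‖² ≤ γ²·(4(1+d²)+50)·Σ‖W‖²` (leaf-10-g3's `VariationalVectorPoincareNear.nsqV_QvL_sub_le` (p219305) BY NAME), and the miss is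
REPAIRED by a leaf-V-UB competitor `g` of the datum `T` for `r` (DISPLAYED hypothesis `hUB1` — exactly the conclusion shape of leaf-03-g4's
`VectorLineTransportUpperBound.exists_ubV_line_ScV` (p218278) at `(n, M) := (L, fine n M)`), Minkowski for the curl form closing the bracket shape:
    **`blockSpin_QT_le`**: `blockSpin (QvL L (fine n M) T) (SfV n L M R′ 0) W ≤ ( √( ScV n M Rc G W + 4(d+26)(L∕n²)·ρ_V W ) + (δ′ + n·γ·√(Λ₁(4(1+d²)+50)))·√(qWV n M W) )²`
with `δ′ = nL√(d(50p²∕L + (32(1+d²)+400)m²)∕2)` as in file 5 — the `hONE` binder of `vector_pair_bracket_sqrt` for the pure curl form and the ACTUAL carrier `Q_T`.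
CONTENT: §1 `QvL` is linear in the field; §2 Minkowski for `curlSq` ∕ `SfV`; §3 the END.

HONEST FRAMING (T4-DAG p. 1).  Model level (frames ∕ transports ∕ `G`, `G′` DATA); [folklore]; leaf V-UB for the actual carrier is a HYPOTHESIS of exactly the tree's
shape, not re-proved; nothing printed is a hypothesis; no `def`, no `def … : Prop`, no `sorry`; axioms standard.  The CURL form only (V-GF displayed elsewhere); NE2 NOT
proved; spine PROVED 0∕9; rung (B)+1 finite T⁴ — NOT infinite volume, NOT mass gap, NOT Clay.  HONEST DEPENDENCY (cell, verbatim): continuum YM on T⁴ ⇐ BetaPertH ∧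
nine spine estimates (0/9 proved); BetaPertH ⇐ (D1) ∧ (D4) ∧ CAP+tail; G-an2-4 gates asym, D1 and NE2/3/4.
-/

noncomputable section

namespace Summit.QuantumFields.BalabanUV.T4Continuum.VariationalVectorOneStepRepair

open Finset
open Literature.MathematicalPhysics.QuantumFieldTheory.Balaban1983to89
open Literature.MathematicalPhysics.QuantumFieldTheory.Balaban1983to89.B5Prop11Plancherel (Tor fine unitVec)
open Literature.MathematicalPhysics.QuantumFieldTheory.Balaban1983to89.B5Block118 (tstep bpt)
open Literature.MathematicalPhysics.QuantumFieldTheory.Balaban1983to89.B5AverageCurlStokes (sum_blocks_real)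
open Summit.QuantumFields.BalabanUV.T4Continuum.VariationalTransfer (blockSpin blockSpin_le)
open Summit.QuantumFields.BalabanUV.T4Continuum.VariationalCovariantFederbush (sum_sq_add_le)
open Summit.QuantumFields.BalabanUV.T4Continuum.VariationalColourFederbush (norm_le_one_of_mem_unitary)
open Summit.QuantumFields.BalabanUV.T4Continuum.VariationalColourInterpolant (norm_star_apply_le)
open Summit.QuantumFields.BalabanUV.T4Continuum.VectorBlockTrialForm (nsqV nsqV_nonneg QvL)
open Summit.QuantumFields.BalabanUV.T4Continuum.VariationalVectorForm (cdV curlV curlSq curlSq_nonneg ScV SfV qWV ScV_nonneg SfV_nonneg qWV_nonneg)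
open Summit.QuantumFields.BalabanUV.T4Continuum.VariationalVectorPoincareNear (nsqV_QvL_sub_le)
open Summit.QuantumFields.BalabanUV.T4Continuum.VariationalVectorInterpolant (PhiFV interpV frameT QvL_interpV)
open Summit.QuantumFields.BalabanUV.T4Continuum.VariationalVectorOneStep (plaq sum_norm_sq_PhiFV_le)
open Summit.QuantumFields.BalabanUV.T4Continuum.VariationalVectorOneStepPhys (rhoV rhoV_nonneg SfV_interpV_le)

variable {d : ℕ} {E : Type*} [NormedAddCommGroup E] [InnerProductSpace ℂ E] [CompleteSpace E]

/-! ## §1 `Q_T` is linear in the field -/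

section Linear

variable (L : ℕ) [NeZero L] (N : Fin d → ℕ) [∀ μ, NeZero (N μ)]

omit [NeZero L] [∀ μ, NeZero (N μ)] [CompleteSpace E] in
/-- `Q_T(A − B) = Q_T A − Q_T B`. [folklore] -/
theorem QvL_sub (T : Tor N → (Fin d → Fin L) → Fin L → Fin d → (E →L[ℂ] E)) (A B : Tor (fine L N) → Fin d → E) :
    QvL L N T (A - B) = QvL L N T A - QvL L N T B := by
  funext y μ
  simp only [QvL, Pi.sub_apply, map_sub, sum_sub_distrib, smul_sub]

end Linear

/-! ## §2 Minkowski for the curl form -/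

section Mink

variable (N : Fin d → ℕ) [∀ μ, NeZero (N μ)]

omit [∀ μ, NeZero (N μ)] [CompleteSpace E] in
/-- `curl_R(A − B) = curl_R A − curl_R B`. [folklore] -/
theorem curlV_sub (R : Tor N → Fin d → (E →L[ℂ] E)) (A B : Tor N → Fin d → E) (x : Tor N) (μ ν : Fin d) :
    curlV N R (A - B) x μ ν = curlV N R A x μ ν - curlV N R B x μ ν := by
  simp only [curlV, cdV, Pi.sub_apply, map_sub]
  abel

omit [CompleteSpace E] in
/-- **MINKOWSKI FOR THE CURL FORM**: `curlSq_R(A − B) ≤ (√curlSq_R A + √curlSq_R B)²`. [folklore] -/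
theorem curlSq_sub_le (R : Tor N → Fin d → (E →L[ℂ] E)) (A B : Tor N → Fin d → E) :
    curlSq N R (A - B) ≤ (Real.sqrt (curlSq N R A) + Real.sqrt (curlSq N R B)) ^ 2 := by
  have hflat : ∀ g : Tor N → Fin d → Fin d → ℝ, ∑ x, ∑ μ, ∑ ν, g x μ ν = ∑ σ : Tor N × (Fin d × Fin d), g σ.1 σ.2.1 σ.2.2 := by
    intro g; rw [Fintype.sum_prod_type]; simp only [Fintype.sum_prod_type]
  set a : Tor N × (Fin d × Fin d) → ℝ := fun σ => ‖curlV N R A σ.1 σ.2.1 σ.2.2‖ with ha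
  set b : Tor N × (Fin d × Fin d) → ℝ := fun σ => ‖curlV N R B σ.1 σ.2.1 σ.2.2‖ with hb
  have hpt : ∀ σ : Tor N × (Fin d × Fin d), ‖curlV N R (A - B) σ.1 σ.2.1 σ.2.2‖ ^ 2 ≤ (a σ + 1 * b σ) ^ 2 := fun σ => by
    rw [one_mul, curlV_sub]
    exact pow_le_pow_left₀ (norm_nonneg _) (norm_sub_le _ _) 2
  have hA : ∑ σ : Tor N × (Fin d × Fin d), a σ ^ 2 = curlSq N R A := by unfold curlSq; rw [hflat]
  have hB : ∑ σ : Tor N × (Fin d × Fin d), b σ ^ 2 = curlSq N R B := by unfold curlSq; rw [hflat]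
  have hmink := sum_sq_add_le (univ : Finset (Tor N × (Fin d × Fin d))) a b zero_le_one
  rw [one_mul, hA, hB] at hmink
  unfold curlSq
  rw [hflat]
  exact (sum_le_sum fun σ _ => hpt σ).trans hmink

end Mink

/-! ## §3 The repair: the curl half of `hONE` for a general line-indexed carrier near the frame-adapted one -/

section Repair

variable (n L : ℕ) [NeZero n] [NeZero L] (M : Fin d → ℕ) [hM : ∀ μ, NeZero (M μ)]
variable {Rc : Tor (fine n M) → Fin d → (E →L[ℂ] E)} {R' : Tor (fine L (fine n M)) → Fin d → (E →L[ℂ] E)}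
variable {U' : Tor (fine L (fine n M)) → (E →L[ℂ] E)} {m p : ℝ}

omit [CompleteSpace E] in
/-- Minkowski for the pure-curl fine form: `SfV_0(A − B) ≤ (√SfV_0 A + √SfV_0 B)²`. [folklore] -/
theorem SfV_zero_sub_le (R' : Tor (fine L (fine n M)) → Fin d → (E →L[ℂ] E)) (A B : Tor (fine L (fine n M)) → Fin d → E) :
    SfV n L M R' (fun _ => 0) (A - B) ≤ (Real.sqrt (SfV n L M R' (fun _ => 0) A) + Real.sqrt (SfV n L M R' (fun _ => 0) B)) ^ 2 := by
  set c : ℝ := (((n : ℝ) * L) ^ d)⁻¹ * ((n : ℝ) * L) ^ 2 / 2 with hc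
  have hc0 : 0 ≤ c := by positivity
  have hS : ∀ X, SfV n L M R' (fun _ => 0) X = c * curlSq (fine L (fine n M)) R' X := fun X => by unfold SfV; rw [hc]; ring
  rw [hS, hS, hS, Real.sqrt_mul hc0, Real.sqrt_mul hc0]
  have h := curlSq_sub_le (fine L (fine n M)) R' A B
  have hsq : Real.sqrt c ^ 2 = c := Real.sq_sqrt hc0
  calc c * curlSq (fine L (fine n M)) R' (A - B) ≤ c * (Real.sqrt (curlSq (fine L (fine n M)) R' A) + Real.sqrt (curlSq (fine L (fine n M)) R' B)) ^ 2 :=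
        mul_le_mul_of_nonneg_left h hc0
    _ = _ := by rw [← mul_add, mul_pow, hsq]

/-- the fine `ℓ²` size of the competitor: `Σ_x Σ_ν ‖Λ′(x,ν)‖² ≤ (4(1+d²)+50)·L^d·nsqV (fine n M) W` (unitary frames, contractive `Rc`). [folklore] -/
theorem nsqV_interpV_le (hU : ∀ x, U' x ∈ unitary (E →L[ℂ] E)) (hRc : ∀ y μ, ‖Rc y μ‖ ≤ 1) (W : Tor (fine n M) → Fin d → E) :
    nsqV (fine L (fine n M)) (interpV L (fine n M) U' Rc W) ≤ (4 * (1 + (d : ℝ) ^ 2) + 50) * ((L : ℝ) ^ d * nsqV (fine n M) W) := by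
  unfold nsqV
  rw [Finset.sum_comm]
  calc ∑ ν : Fin d, ∑ x : Tor (fine L (fine n M)), ‖interpV L (fine n M) U' Rc W x ν‖ ^ 2
      ≤ ∑ ν : Fin d, ∑ x : Tor (fine L (fine n M)), ‖PhiFV L (fine n M) Rc W x ν‖ ^ 2 :=
        sum_le_sum fun ν _ => sum_le_sum fun x _ => pow_le_pow_left₀ (norm_nonneg _) (norm_star_apply_le (hU x) _) 2
    _ ≤ ∑ ν : Fin d, (4 * (1 + (d : ℝ) ^ 2) + 50) * ((L : ℝ) ^ d * ∑ y : Tor (fine n M), ‖W y ν‖ ^ 2) :=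
        sum_le_sum fun ν _ => sum_norm_sq_PhiFV_le L (fine n M) Rc W hRc ν
    _ = _ := by rw [← mul_sum, ← mul_sum, Finset.sum_comm]

/-- **LEAF V-ONE-1F FOR A GENERAL LINE-INDEXED CARRIER, BY CONSTRAINT REPAIR (the curl half of `hONE`)**: unitary site frames `U′`, unitary coarse bond
operators `Rc` (plaquette defect `≤ p`), fine bond operators `R′` (the two frame defects `≤ m`); an actual carrier `T` with `‖T − frameT U′ Rc‖ ≤ γ` pointwise;
and leaf V-UB for `Q_T` at the intermediate level DISPLAYED in the tree's shape (`hUB1`: `∀ r ∃ g, Q_T g = r ∧ ScV L (fine n M) R′ G′ g ≤ Λ₁·Σ‖r‖²`,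
`G′ ≥ 0` — `VectorLineTransportUpperBound.exists_ubV_line_ScV` at `(n, M) := (L, fine n M)`).  THEN for every coarse 1-form `W` and any `G ≥ 0`,
`blockSpin (Q_T) (SfV n L M R′ 0) W ≤ ( √( ScV n M Rc G W + 4(d+26)(L∕n²)·ρ_V W ) + (δ′ + n·γ·√(Λ₁·(4(1+d²)+50)))·√(qWV n M W) )²`. [folklore] -/
theorem blockSpin_QT_le (hU : ∀ x, U' x ∈ unitary (E →L[ℂ] E)) (hRc1 : ∀ y μ, Rc y μ ∈ unitary (E →L[ℂ] E)) (hm : 0 ≤ m)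
    (hin : ∀ (y : Tor (fine n M)) (j : Fin d → Fin L) (μ : Fin d), (j μ : ℕ) + 1 < L →
      ‖R' (bpt L (fine n M) y j) μ * star (U' (bpt L (fine n M) y j + unitVec (fine L (fine n M)) μ)) - star (U' (bpt L (fine n M) y j))‖ ≤ m)
    (hcross : ∀ (y : Tor (fine n M)) (j : Fin d → Fin L) (μ : Fin d), (j μ : ℕ) + 1 = L →
      ‖R' (bpt L (fine n M) y j) μ * star (U' (bpt L (fine n M) y j + unitVec (fine L (fine n M)) μ))
        - star (U' (bpt L (fine n M) y j)) * Rc y μ‖ ≤ m)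
    (hp : ∀ y μ ν, ‖plaq (fine n M) Rc y μ ν‖ ≤ p) {G : (Tor (fine n M) → Fin d → E) → ℝ} (hG0 : ∀ W, 0 ≤ G W)
    {G' : (Tor (fine L (fine n M)) → Fin d → E) → ℝ} (hG0' : ∀ W', 0 ≤ G' W')
    {T : Tor (fine n M) → (Fin d → Fin L) → Fin L → Fin d → (E →L[ℂ] E)} {γ : ℝ} (hγ : 0 ≤ γ)
    (hT : ∀ y j t ν, ‖T y j t ν - frameT L (fine n M) U' Rc y j t ν‖ ≤ γ) {Λ₁ : ℝ} (hΛ₁ : 0 ≤ Λ₁)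
    (hUB1 : ∀ r : Tor (fine n M) → Fin d → E, ∃ g : Tor (fine L (fine n M)) → Fin d → E,
      QvL L (fine n M) T g = r ∧ ScV L (fine n M) R' G' g ≤ Λ₁ * nsqV (fine n M) r)
    (W : Tor (fine n M) → Fin d → E) :
    blockSpin (QvL L (fine n M) T) (SfV n L M R' (fun _ => 0)) W
      ≤ (Real.sqrt (ScV n M Rc G W + 4 * ((d : ℝ) + 26) * ((L : ℝ) / (n : ℝ) ^ 2) * rhoV n M Rc W)
          + ((n : ℝ) * L * Real.sqrt (d * (50 * p ^ 2 / L + (32 * (1 + (d : ℝ) ^ 2) + 400) * m ^ 2) / 2)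
              + (n : ℝ) * γ * Real.sqrt (Λ₁ * (4 * (1 + (d : ℝ) ^ 2) + 50))) * Real.sqrt (qWV n M W)) ^ 2 := by
  have hn : (0 : ℝ) < n := by exact_mod_cast Nat.pos_of_ne_zero (NeZero.ne n)
  have hL : (0 : ℝ) < L := by exact_mod_cast Nat.pos_of_ne_zero (NeZero.ne L)
  have hnd : (0 : ℝ) < (n : ℝ) ^ d := pow_pos hn d
  have hLd : (0 : ℝ) < (L : ℝ) ^ d := pow_pos hL d
  have hRc : ∀ y μ, ‖Rc y μ‖ ≤ 1 := fun y μ => norm_le_one_of_mem_unitary (hRc1 y μ)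
  set C₁ : ℝ := 4 * (1 + (d : ℝ) ^ 2) + 50 with hC₁
  have hC₁0 : 0 ≤ C₁ := by positivity
  -- the competitor, its exact frame-adapted constraint, and its constraint miss under `T`
  set Λ' := interpV L (fine n M) U' Rc W with hΛ'
  have hQf : QvL L (fine n M) (frameT L (fine n M) U' Rc) Λ' = W := QvL_interpV L (fine n M) Rc W hU
  set r : Tor (fine n M) → Fin d → E := QvL L (fine n M) T Λ' - W with hr
  have hr' : r = QvL L (fine n M) T Λ' - QvL L (fine n M) (frameT L (fine n M) U' Rc) Λ' := by rw [hr, hQf]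
  have hrsz : nsqV (fine n M) r ≤ γ ^ 2 * C₁ * nsqV (fine n M) W := by
    rw [hr']
    refine (nsqV_QvL_sub_le L (fine n M) hT Λ').trans ?_
    unfold qWV
    calc γ ^ 2 * (((L : ℝ) ^ d)⁻¹ * nsqV (fine L (fine n M)) Λ') ≤ γ ^ 2 * (((L : ℝ) ^ d)⁻¹ * (C₁ * ((L : ℝ) ^ d * nsqV (fine n M) W))) := by
          gcongr; exact nsqV_interpV_le n L M hU hRc W
      _ = γ ^ 2 * C₁ * nsqV (fine n M) W := by field_simp
  -- the repair competitor
  obtain ⟨g, hg, hSg⟩ := hUB1 r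
  have hQ : QvL L (fine n M) T (Λ' - g) = W := by rw [QvL_sub, hg, hr]; abel
  -- its pure-curl fine form
  have hSg0 : SfV n L M R' (fun _ => 0) g ≤ ((n : ℝ) ^ d)⁻¹ * (n : ℝ) ^ 2 * (Λ₁ * (γ ^ 2 * C₁ * nsqV (fine n M) W)) := by
    have h1 : SfV n L M R' (fun _ => 0) g = ((n : ℝ) ^ d)⁻¹ * (n : ℝ) ^ 2 * (((L : ℝ) ^ d)⁻¹ * ((L : ℝ) ^ 2 * (curlSq (fine L (fine n M)) R' g / 2))) := by
      unfold SfV; rw [mul_pow, mul_pow, mul_inv]; ring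
    have h2 : ((L : ℝ) ^ d)⁻¹ * ((L : ℝ) ^ 2 * (curlSq (fine L (fine n M)) R' g / 2)) ≤ ScV L (fine n M) R' G' g := by
      unfold ScV; have := hG0' g; gcongr; linarith
    rw [h1]
    exact mul_le_mul_of_nonneg_left (h2.trans (hSg.trans (mul_le_mul_of_nonneg_left hrsz hΛ₁))) (by positivity)
  have hSg0' : SfV n L M R' (fun _ => 0) g ≤ ((n : ℝ) * γ * Real.sqrt (Λ₁ * C₁) * Real.sqrt (qWV n M W)) ^ 2 := by
    refine hSg0.trans (le_of_eq ?_)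
    have hq : qWV n M W = ((n : ℝ) ^ d)⁻¹ * nsqV (fine n M) W := rfl
    rw [mul_pow, mul_pow, mul_pow, Real.sq_sqrt (by positivity), Real.sq_sqrt (qWV_nonneg n M W), hq]
    ring
  -- the frame-adapted competitor's bound (file 5)
  have hΛ := SfV_interpV_le n L M hU hRc1 hm hin hcross hp hG0 W
  set A : ℝ := Real.sqrt (ScV n M Rc G W + 4 * ((d : ℝ) + 26) * ((L : ℝ) / (n : ℝ) ^ 2) * rhoV n M Rc W) with hA
  set B : ℝ := (n : ℝ) * L * Real.sqrt (d * (50 * p ^ 2 / L + (32 * (1 + (d : ℝ) ^ 2) + 400) * m ^ 2) / 2) * Real.sqrt (qWV n M W) with hB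
  set D : ℝ := (n : ℝ) * γ * Real.sqrt (Λ₁ * C₁) * Real.sqrt (qWV n M W) with hD
  have hA0 : 0 ≤ A := Real.sqrt_nonneg _
  have hB0 : 0 ≤ B := by positivity
  have hD0 : 0 ≤ D := by positivity
  have hsΛ : Real.sqrt (SfV n L M R' (fun _ => 0) Λ') ≤ A + B := by
    rw [← Real.sqrt_sq (add_nonneg hA0 hB0)]; exact Real.sqrt_le_sqrt hΛ
  have hsg : Real.sqrt (SfV n L M R' (fun _ => 0) g) ≤ D := by
    rw [← Real.sqrt_sq hD0]; exact Real.sqrt_le_sqrt hSg0'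
  have hmink := SfV_zero_sub_le n L M R' Λ' g
  have h0 : 0 ≤ Real.sqrt (SfV n L M R' (fun _ => 0) Λ') + Real.sqrt (SfV n L M R' (fun _ => 0) g) := by positivity
  calc blockSpin (QvL L (fine n M) T) (SfV n L M R' (fun _ => 0)) W ≤ SfV n L M R' (fun _ => 0) (Λ' - g) :=
        blockSpin_le (SfV_nonneg n L M R' fun _ => le_rfl) hQ
    _ ≤ _ := hmink
    _ ≤ (A + B + D) ^ 2 := pow_le_pow_left₀ h0 (by linarith) 2
    _ = _ := by rw [hB, hD]; ring

end Repair

end Summit.QuantumFields.BalabanUV.T4Continuum.VariationalVectorOneStepRepair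

end
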